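import Mathlib
import Summits.Ventures.PercRepro2.Defs
import Summits.Ventures.PercRepro2.Graph
import Summits.Ventures.PercRepro2.OneColourSwitch
import Summits.Ventures.PercRepro2.RegionHubSign
import Summits.Ventures.PercRepro2.SideSwitch
import Summits.Ventures.PercRepro2.TermSwitchDefs
import Summits.Ventures.PercRepro2.M9LoopTransfer
import Summits.Ventures.PercRepro2.M9EdgeTransfer

/-!
# The four colourings of a single pair of `T`-edges: worlds and `σ_rs` read off the looped
graph (blind cell PercRepro2, p3 g24, 2026-08-28; `proofs/P3-CONJG.md` §4)

For a single edge `er = d–r` and a single edge `es = d–s`, `endsT` is the graph with both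
looped at `d`.  For a colouring `ω` with both `T`-edges `Y` and its three `T`-flips
(`es` flipped, `er` flipped, both flipped), the membership of `d` in the worlds of `{r, s}` and
the connection `r ~ s` in each colour are expressed through six connections of the looped graph
at `ω`: `a = r ~_Y s`, `b = r ~_W s`, `yr = d ~_Y r`, `ys = d ~_Y s`, `wr = d ~_W r`, `ws = d ~_W s`
(`conn_rs_YY`, `conn_rs_compl_YY`, `mem_M2_YY`, `conn_rs_YW`, `conn_rs_compl_YW`, …).  The two
graphs agree off the edges inside `{r, s, d}` (`agreeOff_endsT`), so the worlds of the terminal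
set and `σ_pq` are the same in both (`M9EdgeTransfer`).  Own work; std axioms.
-/

namespace Summit.Ventures.PercRepro2

namespace NoPocket

open Finset Classical RegionHub OneColourSwitch SideSwitch TermSwitch

variable {V : Type*} {E : Type*}

section Looped

variable [DecidableEq E]

/-- The graph with the two `T`-edges `er`, `es` looped at `d`. -/
noncomputable def endsT (ends : E → Sym2 V) (d : V) (er es : E) : E → Sym2 V :=
  Function.update (Function.update ends es s(d, d)) er s(d, d)

variable {ends : E → Sym2 V} {d : V} {er es : E}

/-- `endsT` on `er`. -/
lemma endsT_er : endsT ends d er es er = s(d, d) := by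
  simp [endsT]

/-- `endsT` on `es`. -/
lemma endsT_es (hne : er ≠ es) : endsT ends d er es es = s(d, d) := by
  simp [endsT, Function.update_of_ne hne.symm]

/-- `endsT` on the other edges. -/
lemma endsT_of_ne {e : E} (h1 : e ≠ er) (h2 : e ≠ es) : endsT ends d er es e = ends e := by
  simp [endsT, Function.update_of_ne h1, Function.update_of_ne h2]

/-- `endsT er` is a loop. -/
lemma endsT_er_isDiag : (endsT ends d er es er).IsDiag := by
  rw [endsT_er]; exact Sym2.mk_isDiag_iff.2 rfl

/-- `endsT es` is a loop. -/
lemma endsT_es_isDiag (hne : er ≠ es) : (endsT ends d er es es).IsDiag := by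
  rw [endsT_es hne]; exact Sym2.mk_isDiag_iff.2 rfl

/-- Restoring `er` in the looped graph gives the graph with `es` looped. -/
lemma update_endsT_er {r : V} (her : ends er = s(d, r)) (hne : er ≠ es) :
    Function.update (endsT ends d er es) er s(d, r) = Function.update ends es s(d, d) := by
  simp only [endsT, Function.update_idem]
  have h : s(d, r) = Function.update ends es s(d, d) er := by
    rw [Function.update_of_ne hne, her]
  rw [h]
  exact Function.update_eq_self _ _

/-- Restoring `es` in the looped graph gives the graph with `er` looped. -/
lemma update_endsT_es {s : V} (hes : ends es = s(d, s)) (hne : er ≠ es) :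
    Function.update (endsT ends d er es) es s(d, s) = Function.update ends er s(d, d) := by
  simp only [endsT]
  rw [Function.update_comm hne.symm, Function.update_idem]
  have h : s(d, s) = Function.update ends er s(d, d) es := by
    rw [Function.update_of_ne hne.symm, hes]
  rw [h]
  exact Function.update_eq_self _ _

/-- With both `T`-edges closed, the connections of `ends` are those of the looped graph. -/
lemma conn_iff_endsT_of_closed {ω : Config E} (h1 : ω er = false) (h2 : ω es = false) {u v : V} :
    Conn ends ω u v ↔ Conn (endsT ends d er es) ω u v := by
  constructor
  · refine conn_of_open_agree (fun e he _ => ⟨?_, he⟩)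
    have hr : e ≠ er := by rintro rfl; rw [h1] at he; exact Bool.false_ne_true he
    have hs : e ≠ es := by rintro rfl; rw [h2] at he; exact Bool.false_ne_true he
    exact endsT_of_ne hr hs
  · refine conn_of_open_agree (fun e he _ => ⟨?_, he⟩)
    have hr : e ≠ er := by rintro rfl; rw [h1] at he; exact Bool.false_ne_true he
    have hs : e ≠ es := by rintro rfl; rw [h2] at he; exact Bool.false_ne_true he
    exact (endsT_of_ne hr hs).symm

/-- With `es` closed, the connections of `ends` are those of the graph with `es` looped. -/
lemma conn_iff_update_es_of_closed {ω : Config E} (h2 : ω es = false) {u v : V} :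
    Conn ends ω u v ↔ Conn (Function.update ends es s(d, d)) ω u v := by
  constructor
  · refine conn_of_open_agree (fun e he _ => ⟨?_, he⟩)
    have hs : e ≠ es := by rintro rfl; rw [h2] at he; exact Bool.false_ne_true he
    exact Function.update_of_ne hs _ _
  · refine conn_of_open_agree (fun e he _ => ⟨?_, he⟩)
    have hs : e ≠ es := by rintro rfl; rw [h2] at he; exact Bool.false_ne_true he
    exact (Function.update_of_ne hs _ _).symm

/-- With `er` closed, the connections of `ends` are those of the graph with `er` looped. -/
lemma conn_iff_update_er_of_closed {ω : Config E} (h1 : ω er = false) {u v : V} :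
    Conn ends ω u v ↔ Conn (Function.update ends er s(d, d)) ω u v := by
  constructor
  · refine conn_of_open_agree (fun e he _ => ⟨?_, he⟩)
    have hr : e ≠ er := by rintro rfl; rw [h1] at he; exact Bool.false_ne_true he
    exact Function.update_of_ne hr _ _
  · refine conn_of_open_agree (fun e he _ => ⟨?_, he⟩)
    have hr : e ≠ er := by rintro rfl; rw [h1] at he; exact Bool.false_ne_true he
    exact (Function.update_of_ne hr _ _).symm

/-- Recolouring `er` does not change the connections of the looped graph. -/
lemma conn_endsT_update_er {ω : Config E} {b : Bool} {u v : V} :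
    Conn (endsT ends d er es) (Function.update ω er b) u v ↔ Conn (endsT ends d er es) ω u v :=
  M9Reduce.conn_update_loop_iff endsT_er_isDiag

/-- Recolouring `es` does not change the connections of the looped graph. -/
lemma conn_endsT_update_es (hne : er ≠ es) {ω : Config E} {b : Bool} {u v : V} :
    Conn (endsT ends d er es) (Function.update ω es b) u v ↔ Conn (endsT ends d er es) ω u v :=
  M9Reduce.conn_update_loop_iff (endsT_es_isDiag hne)

end Looped

section Agree

variable [DecidableEq E] {ends : E → Sym2 V} {r s d : V} {er es : E}

/-- `ends` and `endsT` agree off the edges inside `{r, s, d}` for colourings agreeing off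
`er, es`. -/
lemma agreeOff_endsT (her : ends er = s(d, r)) (hes : ends es = s(d, s)) {ω ω' : Config E}
    (hω : ∀ e, e ≠ er → e ≠ es → ω' e = ω e) :
    AgreeOff ends (endsT ends d er es) ({r, s, d} : Set V) ω ω' := by
  intro e
  by_cases h1 : e = er
  · left
    intro z hz
    rw [h1, her, Sym2.mem_iff] at hz
    rcases hz with rfl | rfl <;> simp
  by_cases h2 : e = es
  · left
    intro z hz
    rw [h2, hes, Sym2.mem_iff] at hz
    rcases hz with rfl | rfl <;> simp
  · exact Or.inr ⟨endsT_of_ne h1 h2, hω e h1 h2⟩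

/-- The looped graph keeps the edges inside `{r, s, d}` inside `{r, s, d}`. -/
lemma endsT_keeps_inside (e : E) (h : ∀ z ∈ ends e, z ∈ ({r, s, d} : Set V)) :
    ∀ z ∈ endsT ends d er es e, z ∈ ({r, s, d} : Set V) := by
  have hloop : ∀ z ∈ s(d, d), z ∈ ({r, s, d} : Set V) := by
    intro z hz
    rw [Sym2.mem_iff] at hz
    rcases hz with rfl | rfl <;> simp
  by_cases h1 : e = er
  · rw [h1, endsT_er]
    exact hloop
  by_cases h2 : e = es
  · by_cases hne : er = es
    · rw [h2, ← hne, endsT_er]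
      exact hloop
    · rw [h2, endsT_es hne]
      exact hloop
  · rw [endsT_of_ne h1 h2]
    exact h

end Agree

section Eval

variable [DecidableEq E] {ends : E → Sym2 V} {r s d : V} {er es : E}

omit [DecidableEq E] in
/-- `d` lies in the `Y`-world when `er` is open. -/
lemma mem_K2_of_open_er (her : ends er = s(d, r)) {ω : Config E} (h : ω er = true) :
    d ∈ K2 ends r s ω :=
  mem_K2_iff.2 (Or.inl (conn_symm (conn_of_openAdj ⟨er, h, her⟩)))

omit [DecidableEq E] in
/-- `d` lies in the `Y`-world when `es` is open. -/
lemma mem_K2_of_open_es (hes : ends es = s(d, s)) {ω : Config E} (h : ω es = true) :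
    d ∈ K2 ends r s ω :=
  mem_K2_iff.2 (Or.inr (conn_symm (conn_of_openAdj ⟨es, h, hes⟩)))

omit [DecidableEq E] in
/-- `d` lies in the `W`-world when `er` is closed. -/
lemma mem_M2_of_closed_er (her : ends er = s(d, r)) {ω : Config E} (h : ω er = false) :
    d ∈ M2 ends r s ω :=
  mem_K2_of_open_er (ω := OneColourSwitch.compl ω) her (by simp [OneColourSwitch.compl, h])

omit [DecidableEq E] in
/-- `d` lies in the `W`-world when `es` is closed. -/
lemma mem_M2_of_closed_es (hes : ends es = s(d, s)) {ω : Config E} (h : ω es = false) :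
    d ∈ M2 ends r s ω :=
  mem_K2_of_open_es (ω := OneColourSwitch.compl ω) hes (by simp [OneColourSwitch.compl, h])

omit [DecidableEq E] in
/-- **`YY`: `r ~_Y s` through `d`.** -/
lemma conn_rs_YY (her : ends er = s(d, r)) (hes : ends es = s(d, s)) {ω : Config E}
    (h1 : ω er = true) (h2 : ω es = true) : Conn ends ω r s :=
  conn_trans (conn_symm (conn_of_openAdj ⟨er, h1, her⟩)) (conn_of_openAdj ⟨es, h2, hes⟩)

/-- **`YY`: `r ~_W s` is read off the looped graph.** -/
lemma conn_rs_compl_YY {ω : Config E} (h1 : ω er = true) (h2 : ω es = true) :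
    Conn ends (OneColourSwitch.compl ω) r s ↔
      Conn (endsT ends d er es) (OneColourSwitch.compl ω) r s :=
  conn_iff_endsT_of_closed (by simp [OneColourSwitch.compl, h1])
    (by simp [OneColourSwitch.compl, h2])

/-- **`YY`: `d ∈ M₂` iff `d` is `W`-joined to `r` or `s` in the looped graph.** -/
lemma mem_M2_YY {ω : Config E} (h1 : ω er = true) (h2 : ω es = true) :
    d ∈ M2 ends r s ω ↔
      Conn (endsT ends d er es) (OneColourSwitch.compl ω) d r ∨
        Conn (endsT ends d er es) (OneColourSwitch.compl ω) d s := by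
  rw [mem_M2_iff]
  have hc1 : OneColourSwitch.compl ω er = false := by simp [OneColourSwitch.compl, h1]
  have hc2 : OneColourSwitch.compl ω es = false := by simp [OneColourSwitch.compl, h2]
  constructor
  · rintro (h | h)
    · exact Or.inl (conn_symm ((conn_iff_endsT_of_closed hc1 hc2).1 h))
    · exact Or.inr (conn_symm ((conn_iff_endsT_of_closed hc1 hc2).1 h))
  · rintro (h | h)
    · exact Or.inl (conn_symm ((conn_iff_endsT_of_closed hc1 hc2).2 h))
    · exact Or.inr (conn_symm ((conn_iff_endsT_of_closed hc1 hc2).2 h))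

/-- **`WW`: `r ~_Y s` is read off the looped graph.** -/
lemma conn_rs_WW {ω : Config E} (h1 : ω er = false) (h2 : ω es = false) :
    Conn ends ω r s ↔ Conn (endsT ends d er es) ω r s :=
  conn_iff_endsT_of_closed h1 h2

/-- **`WW`: `d ∈ K₂` iff `d` is `Y`-joined to `r` or `s` in the looped graph.** -/
lemma mem_K2_WW {ω : Config E} (h1 : ω er = false) (h2 : ω es = false) :
    d ∈ K2 ends r s ω ↔
      Conn (endsT ends d er es) ω d r ∨ Conn (endsT ends d er es) ω d s := by
  rw [mem_K2_iff]
  constructor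
  · rintro (h | h)
    · exact Or.inl (conn_symm ((conn_iff_endsT_of_closed h1 h2).1 h))
    · exact Or.inr (conn_symm ((conn_iff_endsT_of_closed h1 h2).1 h))
  · rintro (h | h)
    · exact Or.inl (conn_symm ((conn_iff_endsT_of_closed h1 h2).2 h))
    · exact Or.inr (conn_symm ((conn_iff_endsT_of_closed h1 h2).2 h))

/-- **`YW` (`er` open, `es` closed): `r ~_Y s` iff `r ~_Y s` or `d ~_Y s` in the looped
graph.** -/
lemma conn_rs_YW (her : ends er = s(d, r)) (hne : er ≠ es) {ω : Config E}
    (h1 : ω er = true) (h2 : ω es = false) :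
    Conn ends ω r s ↔
      Conn (endsT ends d er es) ω r s ∨ Conn (endsT ends d er es) ω d s := by
  rw [conn_iff_update_es_of_closed (d := d) h2, ← update_endsT_er her hne,
    conn_update_edge_iff endsT_er_isDiag h1]
  constructor
  · rintro (h | ⟨_, h⟩ | ⟨_, h⟩)
    · exact Or.inl h
    · exact Or.inl h
    · exact Or.inr h
  · rintro (h | h)
    · exact Or.inl h
    · exact Or.inr (Or.inr ⟨conn_refl _ _ _, h⟩)

/-- **`WY` (`er` closed, `es` open): `r ~_Y s` iff `r ~_Y s` or `d ~_Y r` in the looped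
graph.** -/
lemma conn_rs_WY (hes : ends es = s(d, s)) (hne : er ≠ es) {ω : Config E}
    (h1 : ω er = false) (h2 : ω es = true) :
    Conn ends ω r s ↔
      Conn (endsT ends d er es) ω r s ∨ Conn (endsT ends d er es) ω d r := by
  rw [conn_iff_update_er_of_closed (d := d) h1, ← update_endsT_es hes hne,
    conn_update_edge_iff (endsT_es_isDiag hne) h2]
  constructor
  · rintro (h | ⟨h, _⟩ | ⟨h, _⟩)
    · exact Or.inl h
    · exact Or.inr (conn_symm h)
    · exact Or.inl h
  · rintro (h | h)
    · exact Or.inl h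
    · exact Or.inr (Or.inl ⟨conn_symm h, conn_refl _ _ _⟩)

end Eval

end NoPocket

end Summit.Ventures.PercRepro2
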